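import Summits.AtomisticToContinuum.Crystallization.Theorems.FrustratedLawDichotomyFarFieldSharp

/-!
# FrustratedLawDichotomy · crux `AperiodicFrustratedLawGap` (stmt-AtomisticToContinuum-27623) — the FAR FORCE COLUMN of the class-A cell certificate
# (hdef side; critic r1737 (C): «two ANALYTIC tail columns join the cell certificate — energy `A_Rc`, force `Σ_k |y_k|·2T(Rc − |n_k|)`»; decomp-a2c, prover hand 1, gen 51)

The tree's Lennard-Jones pair force (summand of `…NashForceBalance.hasSum_force_of_nash`) is `((dist x a)⁻¹ ^ 8 - (dist x a)⁻¹ ^ 14) • (x - a)`,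
of norm `|r⁻⁷ − r⁻¹³| ≤ r⁻⁷ + r⁻¹³` (`r = dist x a`).  Beyond the coherence radius `Rc` of a class-A root the configuration is an ARBITRARY
`7/10`-separated set (`…HardCoreUpgrade`), so the only control on the force it exerts on an interior atom `x` with `dist x root ≤ ρ` is the shell
sum of `r⁻⁷ + r⁻¹³` over separated points at distance `≥ Rc − ρ` from `x`.  The tree already holds the SHARP packing–Abel inverse-power sum
`…FarFieldSharp.sum_inv_pow_le_of_separated_sharp` (hand-2 g15): for `k ≥ 1`, `δ`-separated points at distance `≥ R ≥ δ/2` from the centre,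
`Σ |a − x|^{-(k+3)} ≤ S_k(δ,R) := (3/k)(2/δ)³R⁻ᵏ + (6(k+2)/(k+1))(2/δ)²R^{-(k+1)} + (3/(k+2))(2/δ)R^{-(k+2)} + 2R^{-(k+3)}`.
This module assembles the FORCE column from it (`k = 4` for `r⁻⁷`, `k = 10` for `r⁻¹³`):

* `norm_force_term_le` — `‖((dist x a)⁻¹^8 − (dist x a)⁻¹^14) • (x − a)‖ ≤ (dist x a)⁻¹^7 + (dist x a)⁻¹^13` (no hypothesis; `0⁻¹ = 0` covers `x = a`);
* ★ `sum_norm_force_le_of_separated_sharp` — finite `δ`-separated `s`, all points `≥ R ≥ δ/2` from `x`: `Σ_{a ∈ s} ‖force‖ ≤ S₄(δ,R) + S₁₀(δ,R)`,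
  and `norm_sum_force_le_of_separated_sharp` for `‖Σ_{a ∈ s} force‖`;
* `…_sevenTenths` — at the crux line's hard core `δ = 7/10` the literal column
  `T0(R) = 6000/343·R⁻⁴ + 2880/49·R⁻⁵ + 10/7·R⁻⁶ + 2R⁻⁷ + 2400/343·R⁻¹⁰ + 28800/539·R⁻¹¹ + 5/7·R⁻¹² + 2R⁻¹³`
  (`T0(10) = 2.34·10⁻³`, `T0(14) = 5.6·10⁻⁴` per unit adjoint mass; hand-1 g51 desk table FARCOL-HALO: this crude shell-by-shell column is the one of record —
  mean/affine removal does not pay below `Rc ≈ 15`); a drop-in for the tree's crude force tail `TF(Rc) = (Rc⁻⁷ + Rc⁻¹)·250·(10/7)³·Rc⁻³ ≈ 729·Rc⁻⁴`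
  of `…TransportPriceFiniteForce.truncated_force_le` (`TF(14) = 1.9·10⁻²`: `34×` above `T0(14)`);
* `…_of_far_from_root` — the ROOT-RELATIVE form the certificate uses: far matter at distance `≥ Rc` from the root `c`, interior atom `x` with
  `dist x c ≤ ρ`, `δ/2 ≤ Rc − ρ` ⟹ column `≤ T0` evaluated at `R = Rc − ρ`;
* `summable_force_of_far_sharp`, `norm_tsum_force_le_of_far_sharp(_sevenTenths)` — the same for an infinite `δ`-separated `Y ⊆ ℝ³` (`tsum`, absolutely convergent).

DEF-FREE (the column is written out as a polynomial in `R⁻¹`); imports the tree's `…FarFieldSharp` only; 0 sorry.  Helper lemmas, nothing here closes an item.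
All `[folklore]` (volume packing + Abel summation, as in `…FarFieldSharp`; the per-term bound is the triangle inequality).
-/

noncomputable section

namespace Summit.AtomisticToContinuum.Crystallization.Theorems.FrustratedLawDichotomyFarForceColumn

open scoped BigOperators
open Summit.AtomisticToContinuum.Crystallization.Theorems.FrustratedLawDichotomyFarFieldSharp (sum_inv_pow_le_of_separated_sharp)

/-! ## §1. One term: `‖(r⁻⁸ − r⁻¹⁴)•(x − a)‖ ≤ r⁻⁷ + r⁻¹³` -/

/-- `r⁻¹^(n+1) · r = r⁻¹^n` for every real `r` and `n ≥ 1` (both sides vanish at `r = 0`). [folklore] -/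
theorem inv_pow_succ_mul_self (r : ℝ) {n : ℕ} (hn : 1 ≤ n) : r⁻¹ ^ (n + 1) * r = r⁻¹ ^ n := by
  rcases eq_or_ne r 0 with rfl | hr
  · obtain ⟨m, rfl⟩ := Nat.exists_eq_add_of_le hn
    simp
  · rw [pow_succ, mul_assoc, inv_mul_cancel₀ hr, mul_one]

/-- **Norm of one Lennard-Jones force term**: `‖((dist x a)⁻¹ ^ 8 - (dist x a)⁻¹ ^ 14) • (x - a)‖ ≤ (dist x a)⁻¹ ^ 7 + (dist x a)⁻¹ ^ 13`
(the pair force `φ′(r) = −r⁻¹³ + r⁻⁷` of `φ = r⁻¹²/12 − r⁻⁶/6`, by the triangle inequality; no hypothesis on `x`, `a`). [folklore] -/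
theorem norm_force_term_le (x a : EuclideanSpace ℝ (Fin 3)) :
    ‖((dist x a)⁻¹ ^ 8 - (dist x a)⁻¹ ^ 14) • (x - a)‖ ≤ (dist x a)⁻¹ ^ 7 + (dist x a)⁻¹ ^ 13 := by
  have h0 : 0 ≤ (dist x a)⁻¹ := inv_nonneg.2 dist_nonneg
  rw [norm_smul, Real.norm_eq_abs, ← dist_eq_norm]
  calc |(dist x a)⁻¹ ^ 8 - (dist x a)⁻¹ ^ 14| * dist x a
      ≤ (|(dist x a)⁻¹ ^ 8| + |(dist x a)⁻¹ ^ 14|) * dist x a :=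
        mul_le_mul_of_nonneg_right (abs_sub _ _) dist_nonneg
    _ = (dist x a)⁻¹ ^ (7 + 1) * dist x a + (dist x a)⁻¹ ^ (13 + 1) * dist x a := by
        rw [abs_of_nonneg (pow_nonneg h0 8), abs_of_nonneg (pow_nonneg h0 14), add_mul]
    _ = (dist x a)⁻¹ ^ 7 + (dist x a)⁻¹ ^ 13 := by
        rw [inv_pow_succ_mul_self _ (by norm_num : 1 ≤ 7), inv_pow_succ_mul_self _ (by norm_num : 1 ≤ 13)]

/-! ## §2. The finite far force column (general separation `δ`) -/

/-- ★ **FAR FORCE COLUMN, finite form.**  For a finite `δ`-separated `s ⊂ ℝ³` all of whose points are at distance `≥ R ≥ δ/2` from `x`,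
`Σ_{a ∈ s} ‖((dist x a)⁻¹^8 − (dist x a)⁻¹^14) • (x − a)‖ ≤ S₄(δ,R) + S₁₀(δ,R)` with the sharp packing–Abel sums of `…FarFieldSharp`
(`S_k(δ,R) = (3/k)(2/δ)³R⁻ᵏ + (6(k+2)/(k+1))(2/δ)²R^{-(k+1)} + (3/(k+2))(2/δ)R^{-(k+2)} + 2R^{-(k+3)}`, here `k = 4` and `k = 10`). [folklore] -/
theorem sum_norm_force_le_of_separated_sharp (s : Finset (EuclideanSpace ℝ (Fin 3))) (x : EuclideanSpace ℝ (Fin 3))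
    {δ R : ℝ} (hδ : 0 < δ) (hR : δ / 2 ≤ R)
    (hsep : ∀ a ∈ s, ∀ b ∈ s, a ≠ b → δ ≤ dist a b) (hfar : ∀ a ∈ s, R ≤ dist a x) :
    ∑ a ∈ s, ‖((dist x a)⁻¹ ^ 8 - (dist x a)⁻¹ ^ 14) • (x - a)‖ ≤
      (3 / (4 : ℝ) * (2 / δ) ^ 3 * R⁻¹ ^ 4 + 6 * ((4 : ℝ) + 2) / ((4 : ℝ) + 1) * (2 / δ) ^ 2 * R⁻¹ ^ 5 +
          3 / ((4 : ℝ) + 2) * (2 / δ) * R⁻¹ ^ 6 + 2 * R⁻¹ ^ 7) +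
        (3 / (10 : ℝ) * (2 / δ) ^ 3 * R⁻¹ ^ 10 + 6 * ((10 : ℝ) + 2) / ((10 : ℝ) + 1) * (2 / δ) ^ 2 * R⁻¹ ^ 11 +
          3 / ((10 : ℝ) + 2) * (2 / δ) * R⁻¹ ^ 12 + 2 * R⁻¹ ^ 13) := by
  have h4 := sum_inv_pow_le_of_separated_sharp s x (k := 4) (by norm_num) hδ hR hsep hfar
  have h10 := sum_inv_pow_le_of_separated_sharp s x (k := 10) (by norm_num) hδ hR hsep hfar
  have hterm : ∀ a ∈ s, ‖((dist x a)⁻¹ ^ 8 - (dist x a)⁻¹ ^ 14) • (x - a)‖ ≤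
      (dist a x)⁻¹ ^ (4 + 3) + (dist a x)⁻¹ ^ (10 + 3) := fun a _ => by
    rw [dist_comm a x]
    exact norm_force_term_le x a
  calc ∑ a ∈ s, ‖((dist x a)⁻¹ ^ 8 - (dist x a)⁻¹ ^ 14) • (x - a)‖
      ≤ ∑ a ∈ s, ((dist a x)⁻¹ ^ (4 + 3) + (dist a x)⁻¹ ^ (10 + 3)) := Finset.sum_le_sum hterm
    _ = ∑ a ∈ s, (dist a x)⁻¹ ^ (4 + 3) + ∑ a ∈ s, (dist a x)⁻¹ ^ (10 + 3) := Finset.sum_add_distrib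
    _ ≤ _ := by
        push_cast at h4 h10
        exact add_le_add h4 h10

/-- **FAR FORCE COLUMN, finite vector form**: under the same hypotheses the total force exerted on `x` by the points of `s` has norm
`≤ S₄(δ,R) + S₁₀(δ,R)`. [folklore] -/
theorem norm_sum_force_le_of_separated_sharp (s : Finset (EuclideanSpace ℝ (Fin 3))) (x : EuclideanSpace ℝ (Fin 3))
    {δ R : ℝ} (hδ : 0 < δ) (hR : δ / 2 ≤ R)
    (hsep : ∀ a ∈ s, ∀ b ∈ s, a ≠ b → δ ≤ dist a b) (hfar : ∀ a ∈ s, R ≤ dist a x) :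
    ‖∑ a ∈ s, ((dist x a)⁻¹ ^ 8 - (dist x a)⁻¹ ^ 14) • (x - a)‖ ≤
      (3 / (4 : ℝ) * (2 / δ) ^ 3 * R⁻¹ ^ 4 + 6 * ((4 : ℝ) + 2) / ((4 : ℝ) + 1) * (2 / δ) ^ 2 * R⁻¹ ^ 5 +
          3 / ((4 : ℝ) + 2) * (2 / δ) * R⁻¹ ^ 6 + 2 * R⁻¹ ^ 7) +
        (3 / (10 : ℝ) * (2 / δ) ^ 3 * R⁻¹ ^ 10 + 6 * ((10 : ℝ) + 2) / ((10 : ℝ) + 1) * (2 / δ) ^ 2 * R⁻¹ ^ 11 +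
          3 / ((10 : ℝ) + 2) * (2 / δ) * R⁻¹ ^ 12 + 2 * R⁻¹ ^ 13) :=
  (norm_sum_le _ _).trans (sum_norm_force_le_of_separated_sharp s x hδ hR hsep hfar)

/-! ## §3. At the crux line's hard core `δ = 7/10`: the literal column `T0(R)` -/

/-- The sharp sums at `δ = 7/10`, `k = 4` and `k = 10`, as one polynomial in `R⁻¹`:
`T0(R) = 6000/343·R⁻⁴ + 2880/49·R⁻⁵ + 10/7·R⁻⁶ + 2R⁻⁷ + 2400/343·R⁻¹⁰ + 28800/539·R⁻¹¹ + 5/7·R⁻¹² + 2R⁻¹³`. [folklore] -/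
theorem sharpSums_sevenTenths_eq (R : ℝ) :
    (3 / (4 : ℝ) * (2 / (7 / 10 : ℝ)) ^ 3 * R⁻¹ ^ 4 + 6 * ((4 : ℝ) + 2) / ((4 : ℝ) + 1) * (2 / (7 / 10 : ℝ)) ^ 2 * R⁻¹ ^ 5 +
          3 / ((4 : ℝ) + 2) * (2 / (7 / 10 : ℝ)) * R⁻¹ ^ 6 + 2 * R⁻¹ ^ 7) +
        (3 / (10 : ℝ) * (2 / (7 / 10 : ℝ)) ^ 3 * R⁻¹ ^ 10 + 6 * ((10 : ℝ) + 2) / ((10 : ℝ) + 1) * (2 / (7 / 10 : ℝ)) ^ 2 * R⁻¹ ^ 11 +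
          3 / ((10 : ℝ) + 2) * (2 / (7 / 10 : ℝ)) * R⁻¹ ^ 12 + 2 * R⁻¹ ^ 13) =
      6000 / 343 * R⁻¹ ^ 4 + 2880 / 49 * R⁻¹ ^ 5 + 10 / 7 * R⁻¹ ^ 6 + 2 * R⁻¹ ^ 7 +
        (2400 / 343 * R⁻¹ ^ 10 + 28800 / 539 * R⁻¹ ^ 11 + 5 / 7 * R⁻¹ ^ 12 + 2 * R⁻¹ ^ 13) := by
  norm_num

/-- ★ **FAR FORCE COLUMN at separation `7/10`** (finite form): for a finite `7/10`-separated `s ⊂ ℝ³` with all points at distance `≥ R ≥ 7/20` from `x`,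
`Σ_{a ∈ s} ‖force‖ ≤ T0(R) = 6000/343·R⁻⁴ + 2880/49·R⁻⁵ + 10/7·R⁻⁶ + 2R⁻⁷ + 2400/343·R⁻¹⁰ + 28800/539·R⁻¹¹ + 5/7·R⁻¹² + 2R⁻¹³`. [folklore] -/
theorem sum_norm_force_le_sevenTenths (s : Finset (EuclideanSpace ℝ (Fin 3))) (x : EuclideanSpace ℝ (Fin 3)) {R : ℝ} (hR : 7 / 20 ≤ R)
    (hsep : ∀ a ∈ s, ∀ b ∈ s, a ≠ b → (7 : ℝ) / 10 ≤ dist a b) (hfar : ∀ a ∈ s, R ≤ dist a x) :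
    ∑ a ∈ s, ‖((dist x a)⁻¹ ^ 8 - (dist x a)⁻¹ ^ 14) • (x - a)‖ ≤
      6000 / 343 * R⁻¹ ^ 4 + 2880 / 49 * R⁻¹ ^ 5 + 10 / 7 * R⁻¹ ^ 6 + 2 * R⁻¹ ^ 7 +
        (2400 / 343 * R⁻¹ ^ 10 + 28800 / 539 * R⁻¹ ^ 11 + 5 / 7 * R⁻¹ ^ 12 + 2 * R⁻¹ ^ 13) := by
  rw [← sharpSums_sevenTenths_eq]
  exact sum_norm_force_le_of_separated_sharp s x (by norm_num) (by linarith) hsep hfar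

/-- **Vector form at `7/10`**: `‖Σ_{a ∈ s} force‖ ≤ T0(R)`. [folklore] -/
theorem norm_sum_force_le_sevenTenths (s : Finset (EuclideanSpace ℝ (Fin 3))) (x : EuclideanSpace ℝ (Fin 3)) {R : ℝ} (hR : 7 / 20 ≤ R)
    (hsep : ∀ a ∈ s, ∀ b ∈ s, a ≠ b → (7 : ℝ) / 10 ≤ dist a b) (hfar : ∀ a ∈ s, R ≤ dist a x) :
    ‖∑ a ∈ s, ((dist x a)⁻¹ ^ 8 - (dist x a)⁻¹ ^ 14) • (x - a)‖ ≤
      6000 / 343 * R⁻¹ ^ 4 + 2880 / 49 * R⁻¹ ^ 5 + 10 / 7 * R⁻¹ ^ 6 + 2 * R⁻¹ ^ 7 +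
        (2400 / 343 * R⁻¹ ^ 10 + 28800 / 539 * R⁻¹ ^ 11 + 5 / 7 * R⁻¹ ^ 12 + 2 * R⁻¹ ^ 13) :=
  (norm_sum_le _ _).trans (sum_norm_force_le_sevenTenths s x hR hsep hfar)

/-! ## §4. The root-relative form used by the certificate -/

/-- **Root-relative far column.**  If every point of the `7/10`-separated `s` is at distance `≥ Rc` from the ROOT `c`, and the interior atom `x` has
`dist x c ≤ ρ` with `7/20 ≤ Rc − ρ`, then the force column at `x` is `≤ T0(Rc − ρ)` (triangle inequality: every `a ∈ s` is `≥ Rc − ρ` from `x`).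
This is the shell-by-shell form `Σ_k |y_k|·T0(Rc − |n_k|)` of the cell certificate, one interior atom at a time. [folklore] -/
theorem sum_norm_force_le_sevenTenths_of_far_from_root (s : Finset (EuclideanSpace ℝ (Fin 3))) (x c : EuclideanSpace ℝ (Fin 3))
    {Rc ρ : ℝ} (hx : dist x c ≤ ρ) (hR : 7 / 20 ≤ Rc - ρ)
    (hsep : ∀ a ∈ s, ∀ b ∈ s, a ≠ b → (7 : ℝ) / 10 ≤ dist a b) (hfar : ∀ a ∈ s, Rc ≤ dist a c) :
    ∑ a ∈ s, ‖((dist x a)⁻¹ ^ 8 - (dist x a)⁻¹ ^ 14) • (x - a)‖ ≤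
      6000 / 343 * (Rc - ρ)⁻¹ ^ 4 + 2880 / 49 * (Rc - ρ)⁻¹ ^ 5 + 10 / 7 * (Rc - ρ)⁻¹ ^ 6 + 2 * (Rc - ρ)⁻¹ ^ 7 +
        (2400 / 343 * (Rc - ρ)⁻¹ ^ 10 + 28800 / 539 * (Rc - ρ)⁻¹ ^ 11 + 5 / 7 * (Rc - ρ)⁻¹ ^ 12 + 2 * (Rc - ρ)⁻¹ ^ 13) := by
  refine sum_norm_force_le_sevenTenths s x hR hsep fun a ha => ?_
  have h1 : Rc ≤ dist a c := hfar a ha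
  have h2 : dist a c ≤ dist a x + dist x c := dist_triangle a x c
  linarith

/-! ## §5. Infinite separated configurations (`tsum`) -/

/-- **Summability of the far force** over an infinite `δ`-separated `Y ⊆ ℝ³` all of whose points are at distance `≥ R ≥ δ/2` from `x`
(the finite columns are uniformly bounded, so the series of norms converges). [folklore] -/
theorem summable_force_of_far_sharp {δ : ℝ} {Y : Set (EuclideanSpace ℝ (Fin 3))} (hδ : 0 < δ)
    (hsep : ∀ a ∈ Y, ∀ b ∈ Y, a ≠ b → δ ≤ dist a b) (x : EuclideanSpace ℝ (Fin 3)) {R : ℝ} (hR : δ / 2 ≤ R)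
    (hfar : ∀ y ∈ Y, R ≤ dist y x) :
    Summable fun y : ↥Y => ((dist x y)⁻¹ ^ 8 - (dist x y)⁻¹ ^ 14) • (x - (y : EuclideanSpace ℝ (Fin 3))) := by
  classical
  refine Summable.of_norm (summable_of_sum_le
    (c := (3 / (4 : ℝ) * (2 / δ) ^ 3 * R⁻¹ ^ 4 + 6 * ((4 : ℝ) + 2) / ((4 : ℝ) + 1) * (2 / δ) ^ 2 * R⁻¹ ^ 5 +
          3 / ((4 : ℝ) + 2) * (2 / δ) * R⁻¹ ^ 6 + 2 * R⁻¹ ^ 7) +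
        (3 / (10 : ℝ) * (2 / δ) ^ 3 * R⁻¹ ^ 10 + 6 * ((10 : ℝ) + 2) / ((10 : ℝ) + 1) * (2 / δ) ^ 2 * R⁻¹ ^ 11 +
          3 / ((10 : ℝ) + 2) * (2 / δ) * R⁻¹ ^ 12 + 2 * R⁻¹ ^ 13))
    (fun y => norm_nonneg _) fun u => ?_)
  set u' : Finset (EuclideanSpace ℝ (Fin 3)) := u.image Subtype.val with hu'
  have hmem : ∀ y ∈ u', y ∈ Y := fun y hy => by
    rw [hu', Finset.mem_image] at hy
    obtain ⟨w, -, rfl⟩ := hy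
    exact w.2
  have hsum_eq : ∑ y ∈ u, ‖((dist x y)⁻¹ ^ 8 - (dist x y)⁻¹ ^ 14) • (x - (y : EuclideanSpace ℝ (Fin 3)))‖ =
      ∑ y ∈ u', ‖((dist x y)⁻¹ ^ 8 - (dist x y)⁻¹ ^ 14) • (x - y)‖ := by
    rw [hu', Finset.sum_image (fun a _ b _ h => Subtype.ext h)]
  rw [hsum_eq]
  exact sum_norm_force_le_of_separated_sharp u' x hδ hR (fun a ha b hb hab => hsep a (hmem a ha) b (hmem b hb) hab)
    fun y hy => hfar y (hmem y hy)

/-- ★ **FAR FORCE COLUMN, infinite form.**  For a `δ`-separated `Y ⊆ ℝ³` all of whose points are at distance `≥ R ≥ δ/2` from `x`,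
`‖Σ'_{y ∈ Y} ((dist x y)⁻¹^8 − (dist x y)⁻¹^14) • (x − y)‖ ≤ S₄(δ,R) + S₁₀(δ,R)`. [folklore] -/
theorem norm_tsum_force_le_of_far_sharp {δ : ℝ} {Y : Set (EuclideanSpace ℝ (Fin 3))} (hδ : 0 < δ)
    (hsep : ∀ a ∈ Y, ∀ b ∈ Y, a ≠ b → δ ≤ dist a b) (x : EuclideanSpace ℝ (Fin 3)) {R : ℝ} (hR : δ / 2 ≤ R)
    (hfar : ∀ y ∈ Y, R ≤ dist y x) :
    ‖∑' y : ↥Y, ((dist x y)⁻¹ ^ 8 - (dist x y)⁻¹ ^ 14) • (x - (y : EuclideanSpace ℝ (Fin 3)))‖ ≤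
      (3 / (4 : ℝ) * (2 / δ) ^ 3 * R⁻¹ ^ 4 + 6 * ((4 : ℝ) + 2) / ((4 : ℝ) + 1) * (2 / δ) ^ 2 * R⁻¹ ^ 5 +
          3 / ((4 : ℝ) + 2) * (2 / δ) * R⁻¹ ^ 6 + 2 * R⁻¹ ^ 7) +
        (3 / (10 : ℝ) * (2 / δ) ^ 3 * R⁻¹ ^ 10 + 6 * ((10 : ℝ) + 2) / ((10 : ℝ) + 1) * (2 / δ) ^ 2 * R⁻¹ ^ 11 +
          3 / ((10 : ℝ) + 2) * (2 / δ) * R⁻¹ ^ 12 + 2 * R⁻¹ ^ 13) := by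
  classical
  have hsum := summable_force_of_far_sharp hδ hsep x hR hfar
  have hnorm : Summable fun y : ↥Y => ‖((dist x y)⁻¹ ^ 8 - (dist x y)⁻¹ ^ 14) • (x - (y : EuclideanSpace ℝ (Fin 3)))‖ :=
    hsum.norm
  refine (norm_tsum_le_tsum_norm hnorm).trans (hnorm.tsum_le_of_sum_le fun u => ?_)
  set u' : Finset (EuclideanSpace ℝ (Fin 3)) := u.image Subtype.val with hu'
  have hmem : ∀ y ∈ u', y ∈ Y := fun y hy => by
    rw [hu', Finset.mem_image] at hy
    obtain ⟨w, -, rfl⟩ := hy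
    exact w.2
  have hsum_eq : ∑ y ∈ u, ‖((dist x y)⁻¹ ^ 8 - (dist x y)⁻¹ ^ 14) • (x - (y : EuclideanSpace ℝ (Fin 3)))‖ =
      ∑ y ∈ u', ‖((dist x y)⁻¹ ^ 8 - (dist x y)⁻¹ ^ 14) • (x - y)‖ := by
    rw [hu', Finset.sum_image (fun a _ b _ h => Subtype.ext h)]
  rw [hsum_eq]
  exact sum_norm_force_le_of_separated_sharp u' x hδ hR (fun a ha b hb hab => hsep a (hmem a ha) b (hmem b hb) hab)
    fun y hy => hfar y (hmem y hy)

/-- **Infinite form at `δ = 7/10`**: `‖Σ'_{y ∈ Y} force‖ ≤ T0(R)` for a `7/10`-separated `Y` with all points at distance `≥ R ≥ 7/20` from `x`. [folklore] -/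
theorem norm_tsum_force_le_of_far_sharp_sevenTenths {Y : Set (EuclideanSpace ℝ (Fin 3))}
    (hsep : ∀ a ∈ Y, ∀ b ∈ Y, a ≠ b → (7 : ℝ) / 10 ≤ dist a b) (x : EuclideanSpace ℝ (Fin 3)) {R : ℝ} (hR : 7 / 20 ≤ R)
    (hfar : ∀ y ∈ Y, R ≤ dist y x) :
    ‖∑' y : ↥Y, ((dist x y)⁻¹ ^ 8 - (dist x y)⁻¹ ^ 14) • (x - (y : EuclideanSpace ℝ (Fin 3)))‖ ≤
      6000 / 343 * R⁻¹ ^ 4 + 2880 / 49 * R⁻¹ ^ 5 + 10 / 7 * R⁻¹ ^ 6 + 2 * R⁻¹ ^ 7 +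
        (2400 / 343 * R⁻¹ ^ 10 + 28800 / 539 * R⁻¹ ^ 11 + 5 / 7 * R⁻¹ ^ 12 + 2 * R⁻¹ ^ 13) := by
  rw [← sharpSums_sevenTenths_eq]
  exact norm_tsum_force_le_of_far_sharp (by norm_num) hsep x (by linarith) hfar

/-! ## §6. Two literals (sanity of the dial; the certificate evaluates `T0` itself) -/

/-- `T0(10) ≤ 117/50000 = 2.34·10⁻³` (per unit adjoint mass; ×2 and ×Σ|y_k| in the certificate). [folklore] -/
theorem farForceColumn_ten_le :
    (6000 / 343 * (10 : ℝ)⁻¹ ^ 4 + 2880 / 49 * (10 : ℝ)⁻¹ ^ 5 + 10 / 7 * (10 : ℝ)⁻¹ ^ 6 + 2 * (10 : ℝ)⁻¹ ^ 7 +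
        (2400 / 343 * (10 : ℝ)⁻¹ ^ 10 + 28800 / 539 * (10 : ℝ)⁻¹ ^ 11 + 5 / 7 * (10 : ℝ)⁻¹ ^ 12 + 2 * (10 : ℝ)⁻¹ ^ 13)) ≤
      117 / 50000 := by
  norm_num

/-- `T0(14) ≤ 57/100000 = 5.7·10⁻⁴`. [folklore] -/
theorem farForceColumn_fourteen_le :
    (6000 / 343 * (14 : ℝ)⁻¹ ^ 4 + 2880 / 49 * (14 : ℝ)⁻¹ ^ 5 + 10 / 7 * (14 : ℝ)⁻¹ ^ 6 + 2 * (14 : ℝ)⁻¹ ^ 7 +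
        (2400 / 343 * (14 : ℝ)⁻¹ ^ 10 + 28800 / 539 * (14 : ℝ)⁻¹ ^ 11 + 5 / 7 * (14 : ℝ)⁻¹ ^ 12 + 2 * (14 : ℝ)⁻¹ ^ 13)) ≤
      57 / 100000 := by
  norm_num

end Summit.AtomisticToContinuum.Crystallization.Theorems.FrustratedLawDichotomyFarForceColumn

end
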